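import Summits.AtomisticToContinuum.HydrodynamicLimit.Theorems.MourreKoopmanChargesStressStrongMixingLowDensityGibbsUniqueness3Estimates
import HarnessLib

/-!
# `StressStrongMixing` · line `birth`, stub `stub_lowDensityGibbsUniqueness3` (infrastructure 3/3):
# the vacancy probability of the exclusion ball is Lipschitz in the activity

Support file for the crux item stmt-AtomisticToContinuum-9584 (`StressStrongMixing`, route
`MourreKoopmanCharges` of `AtomisticToContinuum/HydrodynamicLimit`), serving the registered stub
`stub_lowDensityGibbsUniqueness3` of `Cruxes/StressStrongMixing/Lines/birth.lean`.

For the unit-diameter hard-sphere gas on `ℝ³ × ℝ³` with one-particle intensity `z · Leb ⊗ M` (`M` any probability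
law of the velocity marks) we prove:

* `abs_toReal_hsLocalSpec_empty_vacancy_sub_le` — FINITE VOLUME: for `0 ≤ z ≤ z'`, `z ≤ 1/96` and a bounded region
  `Λ`, the free finite-volume Gibbs probabilities of the vacancy event `V = {no centre in B(0,1)}` at activities `z'`
  and `z` differ by at most `432 (z' - z)`, UNIFORMLY IN `Λ`.  Mechanism (companion file `…Cloud`): realise activity `z'`
  as activity `z` plus an independent Poisson cloud `D` of activity `z' - z`; conditionally on the cloud the gas at
  activity `z'` is the gas at activity `z` with the extra forbidden region `N(D)`; by the tree's decay of boundary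
  influence (`abs_ratio_sub_ratio_le_pow`, Michelen–Perkins contraction) a cloud with no centre in `B(0, k+2)` moves
  the vacancy ratio by at most `(16 z)^k`; and under the tilted cloud law the probability of a centre in `B(0, k+3)` is
  at most `(z' - z) · 8 (k+3)³` (Mecke bound).  Summing the geometric–polynomial series gives the constant `432`.
* `abs_measureReal_vacancy_sub_le` — INFINITE VOLUME: for two DLR states `μ, μ'` (`IsHsLocalGibbs 1`) at activities
  `z ≤ z'` in `[0, 1/96]`, `|μ'(V) - μ(V)| ≤ 432 (z' - z)` (pinning by the free boundary condition, uniformly in the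
  activity, `IsHsLocalGibbs.abs_measureReal_sub_hsLocalSpec_empty_le`).

This is the quantitative half of ingredient (C) of the named fact `HardSphereGibbsLowDensityUniqueness`
(injectivity of `z ↦ ρ(z) = z · G_z(V)` at small activity; Ruelle 1969 §4.3: `ρ(z) = z + O(z²)`).

References: D. Ruelle, *Statistical Mechanics: Rigorous Results* (1969), §4.2–4.3; M. Michelen, W. Perkins,
arXiv:2109.01094, §5.1; D. Dereudre, LNM 2237 (2019), Prop. 10.
-/

noncomputable section

open MeasureTheory ProbabilityTheory Set Filter Function
open scoped ENNReal NNReal Topology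

namespace Summit.AtomisticToContinuum.HydrodynamicLimit.Theorems.MourreKoopmanChargesStressStrongMixing

open Literature.Analysis.FunctionSpaces
open Literature.MathematicalPhysics.KineticTheory
open Literature.MathematicalPhysics.StatisticalMechanics
open Literature.MathematicalPhysics.StatisticalMechanics.HardSphere (Pos Phase window hardCoreSet glue poissonLaw
  IsHardCore)

/-! ## Finite volume: the vacancy probability is Lipschitz in the activity, uniformly in the volume -/

/-- **Lipschitz dependence of the free finite-volume vacancy probability on the activity, uniformly in the
volume.**  For a probability mark law `M`, activities `0 ≤ z ≤ z'` with `z ≤ 1/96`, and a bounded measurable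
region `Λ`, the free hard-sphere Gibbs distributions in `Λ` (unit diameter, intensities `z' · Leb ⊗ M` and
`z · Leb ⊗ M`) give to the vacancy event `{no centre in B(0,1)}` probabilities differing by at most `432 (z' - z)`. -/
theorem abs_toReal_hsLocalSpec_empty_vacancy_sub_le (M : Measure Pos) [IsProbabilityMeasure M] {z z' : ℝ}
    (hz : 0 ≤ z) (hzz' : z ≤ z') (hz1 : z ≤ 1 / 96) {Λ : Set Pos} (hΛ : MeasurableSet Λ)
    (hΛb : Bornology.IsBounded Λ) :
    |(hsLocalSpec 1 ((Real.toNNReal z') • ((volume : Measure Pos).prod M)) Λ ∅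
          {ζ : PointConfig Phase | ζ.count (window (Metric.ball (0 : Pos) 1)) = 0}).toReal -
      (hsLocalSpec 1 ((Real.toNNReal z) • ((volume : Measure Pos).prod M)) Λ ∅
          {ζ : PointConfig Phase | ζ.count (window (Metric.ball (0 : Pos) 1)) = 0}).toReal| ≤ 432 * (z' - z) := by
  classical
  have hδ : 0 ≤ z' - z := sub_nonneg.2 hzz'
  have hW : MeasurableSet (window Λ) := HardSphere.measurableSet_window hΛ
  -- the three intensities on the window
  set m : Measure Phase := ((Real.toNNReal z) • ((volume : Measure Pos).prod M)).restrict (window Λ) with hm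
  set mδ : Measure Phase := ((Real.toNNReal (z' - z)) • ((volume : Measure Pos).prod M)).restrict (window Λ) with hmδ
  have hm' : ((Real.toNNReal z') • ((volume : Measure Pos).prod M)).restrict (window Λ) = mδ + m := by
    rw [smul_prod_eq_add M hz hzz', Measure.restrict_add]
  haveI : IsFiniteMeasure m := isFiniteMeasure_restrict.2 (smul_prod_window_ne_top M z hΛb)
  haveI : IsFiniteMeasure mδ := isFiniteMeasure_restrict.2 (smul_prod_window_ne_top M (z' - z) hΛb)
  have h0 : ∀ x, m {x} = 0 := fun x =>
    nonpos_iff_eq_zero.1 ((Measure.restrict_apply_le _ _).trans_eq (smul_prod_singleton z M x))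
  have h0δ : ∀ x, mδ {x} = 0 := fun x =>
    nonpos_iff_eq_zero.1 ((Measure.restrict_apply_le _ _).trans_eq (smul_prod_singleton (z' - z) M x))
  have h0' : ∀ x, ((Real.toNNReal z') • ((volume : Measure Pos).prod M)) {x} = 0 := smul_prod_singleton z' M
  have h0z : ∀ x, ((Real.toNNReal z) • ((volume : Measure Pos).prod M)) {x} = 0 := smul_prod_singleton z M
  have hmt : ∀ t : ℝ, m {y : Phase | y.1 0 = t} = 0 := fun t =>
    nonpos_iff_eq_zero.1 ((Measure.restrict_apply_le _ _).trans_eq (smul_prod_setOf_fst_apply_zero z M t))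
  set P : Measure (PointConfig Phase) := poissonLaw m with hPdef
  set Pδ : Measure (PointConfig Phase) := poissonLaw mδ with hPδdef
  have hP : IsPoissonPointProcess m P := HardSphere.isPoissonPointProcess_poissonLaw m h0
  have hPδ : IsPoissonPointProcess mδ Pδ := HardSphere.isPoissonPointProcess_poissonLaw mδ h0δ
  haveI := hP.isProbabilityMeasure
  haveI := hPδ.isProbabilityMeasure
  -- the smallness parameter of the decay lemma
  set κ : ℝ := 8 * z with hκdef
  have hκ : ∀ a : Pos, m.real (window (Metric.ball a 1)) ≤ κ := fun a => real_restrict_window_ball_le M hz _ a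
  have hκ0 : 0 ≤ 2 * κ := by positivity
  have h2κ : 2 * κ ≤ 1 / 6 := by rw [hκdef]; linarith
  have h2κ1 : 2 * κ < 1 := by linarith
  -- the vacancy event and the functionals
  set S : Set Phase := window (Metric.ball (0 : Pos) 1) with hSdef
  have hS : MeasurableSet S := HardSphere.measurableSet_window Metric.isOpen_ball.measurableSet
  set V : Set (PointConfig Phase) := {ζ | ζ.count S = 0} with hVdef
  have hVm : MeasurableSet V := measurableSet_count_eq_zero hS
  set N : PointConfig Phase → Set Phase := fun D => ⋃ x ∈ (D : Set Phase), window (Metric.ball x.1 1) with hNdef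
  set Zf : Set Phase → ℝ≥0∞ := fun F => P (hardCoreSet 1 ∩ {ζ : PointConfig Phase | ζ.count F = 0}) with hZf
  have hZ0 : ∀ F, Zf F ≠ 0 := fun F =>
    (lt_of_lt_of_le (ENNReal.ofReal_pos.2 (Real.exp_pos _)) (exp_le_measure_hardCore_void hP 1 F)).ne'
  have hZt : ∀ F, Zf F ≠ ∞ := fun F => measure_ne_top P _
  have hZle : ∀ F G : Set Phase, F ⊆ G → Zf G ≤ Zf F := fun F G hFG =>
    measure_mono (inter_subset_inter_right _ (setOf_count_eq_zero_anti hFG))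
  set a : PointConfig Phase → ℝ≥0∞ := fun D =>
    (hardCoreSet 1 ∩ {ζ : PointConfig Phase | ζ.count (∅ : Set Phase) = 0}).indicator (1 : PointConfig Phase → ℝ≥0∞) D *
      Zf (∅ ∪ N D) with hadef
  set ρ : PointConfig Phase → ℝ≥0∞ := fun D => V.indicator (1 : PointConfig Phase → ℝ≥0∞) D *
    (Zf (S ∪ N D) / Zf (∅ ∪ N D)) with hρdef
  set r₀ : ℝ≥0∞ := Zf (∅ ∪ S) / Zf ∅ with hr₀def
  set U : ℕ → Set Phase := fun k => window (Metric.ball (0 : Pos) ((k : ℝ) + 3)) with hUdef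
  have hU : ∀ k, MeasurableSet (U k) := fun k => HardSphere.measurableSet_window Metric.isOpen_ball.measurableSet
  set e : PointConfig Phase → ℝ≥0∞ := fun D => ∑' k, ENNReal.ofReal ((2 * κ) ^ k) *
    {ζ : PointConfig Phase | ζ.count (U k) ≠ 0}.indicator (1 : PointConfig Phase → ℝ≥0∞) D with hedef
  -- measurability
  have ha : Measurable a := measurable_cloudWeight 1 MeasurableSet.empty P
  have hρm : Measurable ρ := (measurable_one.indicator hVm).mul
    ((measurable_measure_hardCore_void_biUnion 1 hS P).div
      (measurable_measure_hardCore_void_biUnion 1 MeasurableSet.empty P))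
  -- the two integrals are the hard-core (void) probabilities at activity `z'`
  have hIa : ∫⁻ D, a D ∂Pδ = poissonLaw (mδ + m) (hardCoreSet 1 ∩ {ζ : PointConfig Phase | ζ.count (∅ : Set Phase) = 0}) :=
    (measure_hardCore_void_add_eq_lintegral h0δ h0 1 MeasurableSet.empty).symm
  have hIaρ : ∫⁻ D, a D * ρ D ∂Pδ = poissonLaw (mδ + m) (hardCoreSet 1 ∩ {ζ : PointConfig Phase | ζ.count S = 0}) := by
    rw [measure_hardCore_void_add_eq_lintegral h0δ h0 1 hS]
    refine lintegral_congr fun D => ?_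
    change a D * ρ D = (hardCoreSet 1 ∩ {ζ : PointConfig Phase | ζ.count S = 0}).indicator 1 D * Zf (S ∪ N D)
    simp only [hadef, hρdef]
    by_cases hV : D ∈ V
    · by_cases hH : D ∈ hardCoreSet 1 ∩ {ζ : PointConfig Phase | ζ.count (∅ : Set Phase) = 0}
      · have hH' : D ∈ hardCoreSet 1 ∩ {ζ : PointConfig Phase | ζ.count S = 0} := ⟨hH.1, hV⟩
        rw [indicator_of_mem hH, indicator_of_mem hV, indicator_of_mem hH', Pi.one_apply, one_mul, one_mul, one_mul,
          ENNReal.mul_div_cancel (hZ0 _) (hZt _)]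
      · have hH' : D ∉ hardCoreSet 1 ∩ {ζ : PointConfig Phase | ζ.count S = 0} := fun h =>
          hH ⟨h.1, count_emptyset D⟩
        rw [indicator_of_notMem hH, indicator_of_notMem hH', zero_mul, zero_mul, zero_mul]
    · have hH' : D ∉ hardCoreSet 1 ∩ {ζ : PointConfig Phase | ζ.count S = 0} := fun h => hV h.2
      rw [indicator_of_notMem hV, indicator_of_notMem hH', zero_mul, zero_mul, mul_zero]
  -- the two finite-volume probabilities as `∫ a ρ / ∫ a` and `r₀`
  have hspec' : (hsLocalSpec 1 ((Real.toNNReal z') • ((volume : Measure Pos).prod M)) Λ ∅ V).toReal =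
      ((∫⁻ D, a D * ρ D ∂Pδ) / ∫⁻ D, a D ∂Pδ).toReal := by
    rw [hsLocalSpec_empty_apply_eq_mul _ h0' 1 hΛ hVm, hm', hIa, hIaρ, hardCoreSet_inter_count_empty, inter_comm,
      ENNReal.div_eq_inv_mul]
  have hspec : (hsLocalSpec 1 ((Real.toNNReal z) • ((volume : Measure Pos).prod M)) Λ ∅ V).toReal = r₀.toReal := by
    rw [toReal_hsLocalSpec_empty_setOf_count_eq_zero _ h0z 1 hΛ hS, hr₀def, ENNReal.toReal_div, measureReal_def,
      measureReal_def]
  -- pointwise bounds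
  have hρ1 : ∀ D, ρ D ≤ 1 := fun D => by
    simp only [hρdef]
    refine mul_le_one' (indicator_apply_le' (fun _ => le_rfl) (fun _ => zero_le_one)) ?_
    exact ENNReal.div_le_of_le_mul (by rw [one_mul]; exact hZle _ _ (union_subset_union_left _ (empty_subset S)))
  have hr₀1 : r₀ ≤ 1 :=
    ENNReal.div_le_of_le_mul (by rw [one_mul]; exact hZle _ _ (empty_subset _))
  -- decay: a cloud with no centre in `B(0, k+2)` moves the vacancy ratio by at most `(2κ)^k`
  have hdecay : ∀ (D : PointConfig Phase) (k : ℕ), D.count (window (Metric.ball (0 : Pos) ((k : ℝ) + 2))) = 0 →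
      |(ρ D).toReal - r₀.toReal| ≤ (2 * κ) ^ k := by
    intro D k hDk
    have hDV : D ∈ V := by
      change D.count S = 0
      refine setOf_count_eq_zero_anti (fun y hy => ?_) (show D ∈ {ζ : PointConfig Phase | ζ.count _ = 0} from hDk)
      rw [hSdef, HardSphere.mem_window, Metric.mem_ball] at hy
      rw [HardSphere.mem_window, Metric.mem_ball]
      have hk : (0 : ℝ) ≤ k := Nat.cast_nonneg k
      linarith
    have hρD : (ρ D).toReal = P.real (hardCoreSet 1 ∩ {ζ : PointConfig Phase | ζ.count (N D ∪ S) = 0}) /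
        P.real (hardCoreSet 1 ∩ {ζ : PointConfig Phase | ζ.count (N D) = 0}) := by
      simp only [hρdef]
      rw [indicator_of_mem hDV, Pi.one_apply, one_mul, ENNReal.toReal_div, union_comm S, empty_union, measureReal_def,
        measureReal_def]
    have hr₀D : r₀.toReal = P.real (hardCoreSet 1 ∩ {ζ : PointConfig Phase | ζ.count (∅ ∪ S) = 0}) /
        P.real (hardCoreSet 1 ∩ {ζ : PointConfig Phase | ζ.count (∅ : Set Phase) = 0}) := by
      rw [hr₀def, ENNReal.toReal_div, measureReal_def, measureReal_def]
    rw [hρD, hr₀D]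
    have hG : Metric.ball (0 : Pos) (((k : ℝ) + 1) * 1) ⊆ Metric.ball (0 : Pos) ((k : ℝ) + 1) := by rw [mul_one]
    have hF : N D ∩ window (Metric.ball (0 : Pos) ((k : ℝ) + 1)) = ∅ ∩ window (Metric.ball (0 : Pos) ((k : ℝ) + 1)) := by
      rw [empty_inter]
      exact biUnion_window_ball_inter_eq_empty (by rw [show (k : ℝ) + 1 + 1 = (k : ℝ) + 2 by ring]; exact hDk)
    exact abs_ratio_sub_ratio_le_pow one_pos hP hP hmt hmt hκ rfl k 0 hG S hS (subset_refl _) (N D) ∅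
      (measurableSet_biUnion_window_ball_carrier 1 D) MeasurableSet.empty hF
  have hebound : ∀ D, ENNReal.ofReal |(ρ D).toReal - r₀.toReal| ≤ e D := by
    intro D
    have hx1 : |(ρ D).toReal - r₀.toReal| ≤ 1 := by
      have h1 : (ρ D).toReal ≤ 1 := ENNReal.toReal_le_of_le_ofReal zero_le_one (by rw [ENNReal.ofReal_one]; exact hρ1 D)
      have h2 : r₀.toReal ≤ 1 := ENNReal.toReal_le_of_le_ofReal zero_le_one (by rw [ENNReal.ofReal_one]; exact hr₀1)
      rw [abs_sub_le_iff]
      constructor <;> linarith [ENNReal.toReal_nonneg (a := ρ D), ENNReal.toReal_nonneg (a := r₀)]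
    have h := ofReal_abs_le_tsum_of_decay hκ0 h2κ1 hx1 (fun k => D.count (U k) ≠ 0) fun k hk => by
      have hk' : D.count (window (Metric.ball (0 : Pos) (((k + 1 : ℕ) : ℝ) + 2))) = 0 := by
        rw [show (((k + 1 : ℕ) : ℝ) + 2) = (k : ℝ) + 3 by push_cast; ring]
        exact not_not.1 hk
      exact hdecay D (k + 1) hk'
    refine h.trans (le_of_eq (tsum_congr fun k => ?_))
    simp only [indicator_apply, mem_setOf_eq, Pi.one_apply]
  have hup : ∀ D, ρ D ≤ r₀ + e D := fun D => by
    have hfin : ρ D ≠ ∞ := ne_top_of_le_ne_top ENNReal.one_ne_top (hρ1 D)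
    have hr₀fin : r₀ ≠ ∞ := ne_top_of_le_ne_top ENNReal.one_ne_top hr₀1
    calc ρ D = ENNReal.ofReal (ρ D).toReal := (ENNReal.ofReal_toReal hfin).symm
      _ ≤ ENNReal.ofReal (r₀.toReal + |(ρ D).toReal - r₀.toReal|) :=
          ENNReal.ofReal_le_ofReal (by linarith [le_abs_self ((ρ D).toReal - r₀.toReal)])
      _ = r₀ + ENNReal.ofReal |(ρ D).toReal - r₀.toReal| := by
          rw [ENNReal.ofReal_add ENNReal.toReal_nonneg (abs_nonneg _), ENNReal.ofReal_toReal hr₀fin]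
      _ ≤ r₀ + e D := add_le_add le_rfl (hebound D)
  have hlow : ∀ D, r₀ ≤ ρ D + e D := fun D => by
    have hfin : ρ D ≠ ∞ := ne_top_of_le_ne_top ENNReal.one_ne_top (hρ1 D)
    have hr₀fin : r₀ ≠ ∞ := ne_top_of_le_ne_top ENNReal.one_ne_top hr₀1
    calc r₀ = ENNReal.ofReal r₀.toReal := (ENNReal.ofReal_toReal hr₀fin).symm
      _ ≤ ENNReal.ofReal ((ρ D).toReal + |(ρ D).toReal - r₀.toReal|) :=
          ENNReal.ofReal_le_ofReal (by linarith [neg_abs_le ((ρ D).toReal - r₀.toReal)])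
      _ = ρ D + ENNReal.ofReal |(ρ D).toReal - r₀.toReal| := by
          rw [ENNReal.ofReal_add ENNReal.toReal_nonneg (abs_nonneg _), ENNReal.ofReal_toReal hfin]
      _ ≤ ρ D + e D := add_le_add le_rfl (hebound D)
  -- the Mecke bound on the majorant
  have hint : ∫⁻ D, a D * e D ∂Pδ ≤ ENNReal.ofReal (432 * (z' - z)) * ∫⁻ D, a D ∂Pδ := by
    have hterm : ∀ k, ∫⁻ D, a D * {ζ : PointConfig Phase | ζ.count (U k) ≠ 0}.indicator 1 D ∂Pδ ≤
        mδ (U k) * ∫⁻ D, a D ∂Pδ := fun k => by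
      refine le_trans (lintegral_mono fun D => ?_) (lintegral_cloudWeight_mul_count_le h0δ 1 MeasurableSet.empty P (hU k))
      refine mul_le_mul' le_rfl ?_
      by_cases hD : D ∈ {ζ : PointConfig Phase | ζ.count (U k) ≠ 0}
      · rw [indicator_of_mem hD, Pi.one_apply]
        have h1 : (1 : ℕ∞) ≤ D.count (U k) := Order.one_le_iff_ne_zero.2 hD
        simpa using ENat.toENNReal_le.2 h1
      · rw [indicator_of_notMem hD]; exact bot_le
    calc ∫⁻ D, a D * e D ∂Pδ
        = ∫⁻ D, ∑' k, ENNReal.ofReal ((2 * κ) ^ k) * (a D * {ζ : PointConfig Phase | ζ.count (U k) ≠ 0}.indicator 1 D) ∂Pδ := by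
          refine lintegral_congr fun D => ?_
          simp only [hedef]
          rw [← ENNReal.tsum_mul_left]
          exact tsum_congr fun k => by ring
      _ = ∑' k, ENNReal.ofReal ((2 * κ) ^ k) * ∫⁻ D, a D * {ζ : PointConfig Phase | ζ.count (U k) ≠ 0}.indicator 1 D ∂Pδ := by
          rw [lintegral_tsum fun k => ?_]
          · exact tsum_congr fun k => lintegral_const_mul _ (ha.mul (measurable_one.indicator (measurableSet_count_ne_zero (hU k))))
          · exact ((ha.mul (measurable_one.indicator (measurableSet_count_ne_zero (hU k)))).const_mul _).aemeasurable
      _ ≤ ∑' k, ENNReal.ofReal ((2 * κ) ^ k) * (mδ (U k) * ∫⁻ D, a D ∂Pδ) :=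
          ENNReal.tsum_le_tsum fun k => mul_le_mul' le_rfl (hterm k)
      _ = (∑' k, ENNReal.ofReal ((2 * κ) ^ k) * mδ (U k)) * ∫⁻ D, a D ∂Pδ := by
          rw [← ENNReal.tsum_mul_right]
          exact tsum_congr fun k => by ring
      _ ≤ ENNReal.ofReal (432 * (z' - z)) * ∫⁻ D, a D ∂Pδ := by
          refine mul_le_mul' ?_ le_rfl
          calc ∑' k, ENNReal.ofReal ((2 * κ) ^ k) * mδ (U k)
              ≤ ∑' k : ℕ, ENNReal.ofReal (216 * (z' - z)) * (2⁻¹ : ℝ≥0∞) ^ k := by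
                refine ENNReal.tsum_le_tsum fun k => ?_
                calc ENNReal.ofReal ((2 * κ) ^ k) * mδ (U k)
                    ≤ ENNReal.ofReal ((2 * κ) ^ k) * ENNReal.ofReal (8 * (z' - z) * ((k : ℝ) + 3) ^ 3) :=
                      mul_le_mul' le_rfl (restrict_window_ball_le M hδ _ k)
                  _ = ENNReal.ofReal ((2 * κ) ^ k * (8 * (z' - z) * ((k : ℝ) + 3) ^ 3)) :=
                      (ENNReal.ofReal_mul (pow_nonneg hκ0 k)).symm
                  _ ≤ ENNReal.ofReal (216 * (z' - z) * (2⁻¹) ^ k) :=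
                      ENNReal.ofReal_le_ofReal (pow_mul_cube_le hκ0 h2κ hδ k)
                  _ = ENNReal.ofReal (216 * (z' - z)) * (2⁻¹ : ℝ≥0∞) ^ k := by
                      rw [ENNReal.ofReal_mul (by positivity), ENNReal.ofReal_pow (by positivity),
                        ENNReal.ofReal_inv_of_pos two_pos, ENNReal.ofReal_ofNat]
            _ = ENNReal.ofReal (216 * (z' - z)) * 2 := by
                rw [ENNReal.tsum_mul_left, ENNReal.tsum_geometric, ENNReal.one_sub_inv_two, inv_inv]
            _ = ENNReal.ofReal (432 * (z' - z)) := by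
                rw [mul_comm, ← ENNReal.ofReal_ofNat 2, ← ENNReal.ofReal_mul (by norm_num)]
                congr 1
                ring
  -- positivity and finiteness of the normalisation
  have hP' : IsPoissonPointProcess (mδ + m) (poissonLaw (mδ + m)) :=
    HardSphere.isPoissonPointProcess_poissonLaw (mδ + m) fun x => by simp [h0 x, h0δ x]
  haveI := hP'.isProbabilityMeasure
  have hpos : ∫⁻ D, a D ∂Pδ ≠ 0 := by
    rw [hIa]
    exact (lt_of_lt_of_le (ENNReal.ofReal_pos.2 (Real.exp_pos _)) (exp_le_measure_hardCore_void hP' 1 _)).ne'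
  have hfin : ∫⁻ D, a D ∂Pδ ≠ ∞ := by rw [hIa]; exact measure_ne_top _ _
  -- conclusion
  rw [hspec', hspec]
  have h := abs_toReal_div_sub_toReal_le (P := Pδ) ha hρm hρ1 hr₀1 ENNReal.ofReal_ne_top hup hlow hint hpos hfin
  rwa [ENNReal.toReal_ofReal (by nlinarith)] at h

/-! ## Infinite volume: pinning by the free boundary condition, uniformly in the activity -/

/-- **The vacancy probability of a low-activity hard-sphere DLR state is Lipschitz in the activity**: for a
probability mark law `M`, activities `0 ≤ z ≤ z' ≤ 1/96` and DLR states `μ`, `μ'` of the unit-diameter gas with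
intensities `z · Leb ⊗ M`, `z' · Leb ⊗ M` (`IsHsLocalGibbs 1`), the probabilities of the vacancy event
`{no centre in B(0,1)}` differ by at most `432 (z' - z)` — both states are pinned by the free finite-volume
distributions in the balls `B(0, d + 3)` up to `2e · 6^{-d}` (Michelen–Perkins), and those are `432 (z'-z)`-close
uniformly in `d` (`abs_toReal_hsLocalSpec_empty_vacancy_sub_le`). -/
theorem abs_measureReal_vacancy_sub_le (M : Measure Pos) [IsProbabilityMeasure M] {z z' : ℝ}
    (hz : 0 ≤ z) (hzz' : z ≤ z') (hz'1 : z' ≤ 1 / 96) {μ μ' : Measure (PointConfig Phase)}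
    (hμ : IsHsLocalGibbs 1 ((Real.toNNReal z) • ((volume : Measure Pos).prod M)) μ)
    (hμ' : IsHsLocalGibbs 1 ((Real.toNNReal z') • ((volume : Measure Pos).prod M)) μ') :
    |μ'.real {ζ : PointConfig Phase | ζ.count (window (Metric.ball (0 : Pos) 1)) = 0} -
      μ.real {ζ : PointConfig Phase | ζ.count (window (Metric.ball (0 : Pos) 1)) = 0}| ≤ 432 * (z' - z) := by
  set S : Set Phase := window (Metric.ball (0 : Pos) 1) with hSdef
  have hS : MeasurableSet S := HardSphere.measurableSet_window Metric.isOpen_ball.measurableSet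
  set V : Set (PointConfig Phase) := {ζ | ζ.count S = 0} with hVdef
  have hVm : MeasurableSet V := measurableSet_count_eq_zero hS
  -- `V` is a local event over `B(0, 1)`
  have hVloc : (PointConfig.restrict (window (Metric.ball (0 : Pos) ((1 : ℕ) : ℝ))) ⁻¹' V :
      Set (PointConfig Phase)) = V := by
    ext ζ
    change (PointConfig.restrict _ ζ).count S = 0 ↔ ζ.count S = 0
    rw [PointConfig.count_restrict, Nat.cast_one, inter_self]
  -- pinning, uniformly in the activity `t ≤ 1/96`
  have pin : ∀ {t : ℝ} {ρ : Measure (PointConfig Phase)}, 0 ≤ t → t ≤ 1 / 96 →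
      IsHsLocalGibbs 1 ((Real.toNNReal t) • ((volume : Measure Pos).prod M)) ρ → ∀ d : ℕ,
      |ρ.real V - (hsLocalSpec 1 ((Real.toNNReal t) • ((volume : Measure Pos).prod M))
        (Metric.ball 0 (((1 : ℕ) : ℝ) + ((d : ℝ) + 2) * 1)) ∅ V).toReal| ≤ 2 * Real.exp 1 * (1 / 6) ^ d := by
    intro t ρ ht ht1 hρ d
    set ν : Measure Phase := (Real.toNNReal t) • ((volume : Measure Pos).prod M) with hν
    haveI : IsLocallyFiniteMeasure ν := by rw [hν]; infer_instance
    have h0 : ∀ x, ν {x} = 0 := smul_prod_singleton t M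
    have hm : ∀ s : ℝ, ν {y : Phase | y.1 0 = s} = 0 := smul_prod_setOf_fst_apply_zero t M
    have hκ0 : (0 : ℝ) ≤ 8 * t := by positivity
    have hκ : ∀ a : Pos, ν (window (Metric.ball a 1)) ≤ ENNReal.ofReal (8 * t) := fun a => by
      rw [hν, smul_prod_window, measure_univ, mul_one, mul_comm (8 : ℝ) t, ENNReal.ofReal_mul ht]
      gcongr
      exact volume_ball_one_le a
    have hfin : ∀ R : ℝ, ν (window (Metric.ball (0 : Pos) R)) ≠ ∞ := fun R =>
      smul_prod_window_ne_top M t Metric.isBounded_ball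
    have h := hρ.abs_measureReal_sub_hsLocalSpec_empty_le ν one_pos h0 hm hκ0 hκ hfin 1 d hVm
    rw [hVloc] at h
    refine h.trans ?_
    have hνW : ν.real (window (Metric.ball (0 : Pos) ((1 : ℕ) : ℝ))) ≤ 1 := by
      rw [Nat.cast_one, measureReal_def]
      calc (ν (window (Metric.ball (0 : Pos) 1))).toReal ≤ (ENNReal.ofReal (8 * t)).toReal :=
            ENNReal.toReal_mono ENNReal.ofReal_ne_top (hκ 0)
        _ = 8 * t := ENNReal.toReal_ofReal hκ0
        _ ≤ 1 := by linarith
    have hνW0 : 0 ≤ ν.real (window (Metric.ball (0 : Pos) ((1 : ℕ) : ℝ))) := measureReal_nonneg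
    have hexp : Real.exp (ν.real (window (Metric.ball (0 : Pos) ((1 : ℕ) : ℝ)))) ≤ Real.exp 1 :=
      Real.exp_le_exp.2 hνW
    have hpow : (2 * (8 * t)) ^ d ≤ (1 / 6 : ℝ) ^ d := pow_le_pow_left₀ (by positivity) (by linarith) d
    calc 2 * ν.real (window (Metric.ball (0 : Pos) ((1 : ℕ) : ℝ))) *
          Real.exp (ν.real (window (Metric.ball (0 : Pos) ((1 : ℕ) : ℝ)))) * (2 * (8 * t)) ^ d
        ≤ 2 * 1 * Real.exp 1 * (1 / 6 : ℝ) ^ d := by gcongr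
      _ = 2 * Real.exp 1 * (1 / 6) ^ d := by ring
  -- the estimate at every depth `d`
  have hd : ∀ d : ℕ, |μ'.real V - μ.real V| ≤ 432 * (z' - z) + 4 * Real.exp 1 * (1 / 6) ^ d := fun d => by
    have h1 := pin hz (hzz'.trans hz'1) hμ d
    have h2 := pin (hz.trans hzz') hz'1 hμ' d
    have h3 := abs_toReal_hsLocalSpec_empty_vacancy_sub_le M hz hzz' (hzz'.trans hz'1)
      (Λ := Metric.ball (0 : Pos) (((1 : ℕ) : ℝ) + ((d : ℝ) + 2) * 1)) Metric.isOpen_ball.measurableSet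
      Metric.isBounded_ball
    rw [abs_sub_comm] at h1
    calc |μ'.real V - μ.real V|
        ≤ |μ'.real V - (hsLocalSpec 1 ((Real.toNNReal z') • ((volume : Measure Pos).prod M))
              (Metric.ball 0 (((1 : ℕ) : ℝ) + ((d : ℝ) + 2) * 1)) ∅ V).toReal| +
          |(hsLocalSpec 1 ((Real.toNNReal z') • ((volume : Measure Pos).prod M))
              (Metric.ball 0 (((1 : ℕ) : ℝ) + ((d : ℝ) + 2) * 1)) ∅ V).toReal - μ.real V| := abs_sub_le _ _ _
      _ ≤ |μ'.real V - (hsLocalSpec 1 ((Real.toNNReal z') • ((volume : Measure Pos).prod M))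
              (Metric.ball 0 (((1 : ℕ) : ℝ) + ((d : ℝ) + 2) * 1)) ∅ V).toReal| +
          (|(hsLocalSpec 1 ((Real.toNNReal z') • ((volume : Measure Pos).prod M))
              (Metric.ball 0 (((1 : ℕ) : ℝ) + ((d : ℝ) + 2) * 1)) ∅ V).toReal -
            (hsLocalSpec 1 ((Real.toNNReal z) • ((volume : Measure Pos).prod M))
              (Metric.ball 0 (((1 : ℕ) : ℝ) + ((d : ℝ) + 2) * 1)) ∅ V).toReal| +
          |(hsLocalSpec 1 ((Real.toNNReal z) • ((volume : Measure Pos).prod M))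
              (Metric.ball 0 (((1 : ℕ) : ℝ) + ((d : ℝ) + 2) * 1)) ∅ V).toReal - μ.real V|) :=
          add_le_add le_rfl (abs_sub_le _ _ _)
      _ ≤ 2 * Real.exp 1 * (1 / 6) ^ d + (432 * (z' - z) + 2 * Real.exp 1 * (1 / 6) ^ d) := by
          gcongr
      _ = 432 * (z' - z) + 4 * Real.exp 1 * (1 / 6) ^ d := by ring
  have htend : Tendsto (fun d : ℕ => 432 * (z' - z) + 4 * Real.exp 1 * (1 / 6 : ℝ) ^ d) atTop
      (𝓝 (432 * (z' - z) + 4 * Real.exp 1 * 0)) :=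
    tendsto_const_nhds.add ((tendsto_pow_atTop_nhds_zero_of_lt_one (by norm_num) (by norm_num)).const_mul _)
  rw [mul_zero, add_zero] at htend
  exact ge_of_tendsto' htend hd

/-- **Registered helper stub (infrastructure 2/3 of `stub_lowDensityGibbsUniqueness3`)**: the Lipschitz bound
`abs_measureReal_vacancy_sub_le` in closed form. -/
theorem lowDensityGibbsUniqueness3_vacancyLipschitz : ∀ (M : Measure Pos), IsProbabilityMeasure M → ∀ (z z' : ℝ) (μ μ' : Measure (PointConfig Phase)), 0 ≤ z → z ≤ z' → z' ≤ 1 / 96 → IsHsLocalGibbs 1 ((Real.toNNReal z) • ((volume : Measure Pos).prod M)) μ → IsHsLocalGibbs 1 ((Real.toNNReal z') • ((volume : Measure Pos).prod M)) μ' → |μ'.real {ζ : PointConfig Phase | ζ.count (window (Metric.ball (0 : Pos) 1)) = 0} - μ.real {ζ : PointConfig Phase | ζ.count (window (Metric.ball (0 : Pos) 1)) = 0}| ≤ 432 * (z' - z) := by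
  intro M hM z z' μ μ' hz hzz' hz'1 hμ hμ'
  haveI := hM
  exact abs_measureReal_vacancy_sub_le M hz hzz' hz'1 hμ hμ'

end Summit.AtomisticToContinuum.HydrodynamicLimit.Theorems.MourreKoopmanChargesStressStrongMixing

end
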